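import Mathlib

/-!
# Line `Sketch` of crux `PhononMeanFreePath.CoherentDephasing` (stmt-AtomisticToContinuum-11810): the block Beer–Lambert law from sitewise passivity and a local Fermi-golden-rule bound

Helper file (pure real analysis over `ℕ`-indexed real families; no chain objects) for the lead's stub
`stub_blockAbsorption` of the registered skeleton `Cruxes/CoherentDephasing/Lines/Sketch.lean`. It isolates the
`N`-uniform content of the block law into two SITEWISE statements.

Setting (one parameter point, one chain length; everything time-integrated over `(0, ∞)`): `J b` is the coherent
(harmonic, symmetric) energy flux through bond `b = (b, b+1)`, `s x` the work extracted from the mean field at site `x`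
by the mean anharmonic force at `x`, and `E x ≥ 0` the time-integrated coherent energy density at site `x`
(`e_x = ½(m_x² + ω₂ n_x²) + ¼((n_x - n_{x-1})² + (n_{x+1} - n_x)²)`). The fixed-`N` site energy balance reads
`J (x-1) - J x = s x` at every bulk site, and `|j_b| ≤ e_b + e_{b+1}` pointwise in time (AM–GM) gives the transport
bound `J b ≤ E b + E (b+1)`. The two `N`-uniform hypotheses are

* sitewise PASSIVITY in the block: `0 ≤ s x`;
* a LOCAL FGR (absorption) bound in the block: `κ · E x ≤ s x` with `κ > 0`.

Conclusions: the flux is non-increasing across the block (`flux_antitone_of_passive`), and over a block of `k` interior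
bonds it drops by the factor `θ(k) = 2 / (κ k + 2)` (`flux_ratio_of_localFGR`: `k · J b' ≤ Σ_interior J ≤ 2 Σ_block E
≤ (2/κ) Σ_block s = (2/κ)(J b - J b')`); hence the block law in the `max`-form consumed by the skeleton
(`blockLaw_of_localFGR`): `(1 - θ(L₀ - 1)) · max (J b) 0 ≤ J b - J b'` whenever `b + L₀ ≤ b'`.

So along this line the crux's `N`-uniform input is reduced to: bulk sitewise passivity of the Gibbs-averaged response
field and a strictly positive lower bound, uniform in the length, on the local absorption rate `s_x / E_x` (the
"finite thermal phonon lifetime" as ONE local inequality between two explicit two-point response functionals).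
-/

noncomputable section

open Finset

namespace Summit.AtomisticToContinuum.FouriersLaw.Theorems.CoherentDephasing.LocalFGR

/-- [folklore] **Passivity makes the flux non-increasing.** If `J (x-1) - J x = s x ≥ 0` at every site `x` with
`b < x ≤ b'`, then `J b' ≤ J b''` for every bond `b ≤ b'' ≤ b'`. -/
theorem flux_antitone_of_passive (J s : ℕ → ℝ) (b b' : ℕ)
    (hbal : ∀ x, b < x → x ≤ b' → J (x - 1) - J x = s x) (hpass : ∀ x, b < x → x ≤ b' → 0 ≤ s x) :
    ∀ b'', b ≤ b'' → b'' ≤ b' → J b' ≤ J b'' := by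
  -- induction on the distance `d = b' - b''`
  suffices h : ∀ d b'', b ≤ b'' → b'' + d = b' → J b' ≤ J b'' by
    intro b'' h1 h2
    exact h (b' - b'') b'' h1 (by omega)
  intro d
  induction d with
  | zero => intro b'' _ h2; simp only [add_zero] at h2; rw [h2]
  | succ d ih =>
    intro b'' h1 h2
    have hstep : J (b'' + 1) ≤ J b'' := by
      have e := hbal (b'' + 1) (by omega) (by omega)
      have p := hpass (b'' + 1) (by omega) (by omega)
      simp only [Nat.add_sub_cancel] at e
      linarith
    exact (ih (b'' + 1) (by omega) (by omega)).trans hstep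

/-- [folklore] Telescoping the site balances: `Σ_{x ∈ (b, b']} s x = J b - J b'`. -/
theorem sum_Ioc_eq_sub (J s : ℕ → ℝ) (b b' : ℕ) (hbb : b ≤ b')
    (hbal : ∀ x, b < x → x ≤ b' → J (x - 1) - J x = s x) :
    ∑ x ∈ Ioc b b', s x = J b - J b' := by
  induction b', hbb using Nat.le_induction with
  | base => simp
  | succ b' hle ih =>
    rw [sum_Ioc_succ_top (by omega), ih (fun x h1 h2 => hbal x h1 (by omega))]
    have e := hbal (b' + 1) (by omega) le_rfl
    simp only [Nat.add_sub_cancel] at e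
    linarith

/-- [folklore] **Flux ratio over a block from the local FGR bound.** With the site balance, passivity and
`κ E x ≤ s x` on the sites of `(b, b']`, `0 ≤ E`, and the transport bound `J b'' ≤ E b'' + E (b''+1)` on the interior
bonds `b < b'' < b'`, the outgoing flux is at most `θ ×` the incoming one, `θ = 2/(κ k + 2)`, `k = b' - b - 1` the
number of interior bonds: `J b' ≤ (2 / (κ k + 2)) · J b`. -/
theorem flux_ratio_of_localFGR (J s E : ℕ → ℝ) (κ : ℝ) (b b' : ℕ) (hκ : 0 < κ) (hbb : b < b')
    (hbal : ∀ x, b < x → x ≤ b' → J (x - 1) - J x = s x) (hpass : ∀ x, b < x → x ≤ b' → 0 ≤ s x)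
    (hfgr : ∀ x, b < x → x ≤ b' → κ * E x ≤ s x) (hE : ∀ x, 0 ≤ E x)
    (htr : ∀ b'', b < b'' → b'' < b' → J b'' ≤ E b'' + E (b'' + 1)) :
    J b' ≤ 2 / (κ * ((b' - b - 1 : ℕ) : ℝ) + 2) * J b := by
  set k : ℕ := b' - b - 1 with hk
  have hmono := flux_antitone_of_passive J s b b' hbal hpass
  -- (1) `k · J b' ≤ Σ_{interior} J`
  have h1 : (k : ℝ) * J b' ≤ ∑ b'' ∈ Ioo b b', J b'' := by
    have hcard : (Ioo b b').card = k := by simp [hk]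
    have : ∑ b'' ∈ Ioo b b', J b' ≤ ∑ b'' ∈ Ioo b b', J b'' :=
      sum_le_sum fun b'' hb'' => by
        rw [mem_Ioo] at hb''
        exact hmono b'' hb''.1.le hb''.2.le
    rwa [sum_const, hcard, nsmul_eq_mul] at this
  -- (2) `Σ_{interior} J ≤ 2 Σ_{(b,b']} E`
  have h2 : ∑ b'' ∈ Ioo b b', J b'' ≤ 2 * ∑ x ∈ Ioc b b', E x := by
    have hle : ∑ b'' ∈ Ioo b b', J b'' ≤ ∑ b'' ∈ Ioo b b', (E b'' + E (b'' + 1)) :=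
      sum_le_sum fun b'' hb'' => by
        rw [mem_Ioo] at hb''
        exact htr b'' hb''.1 hb''.2
    have hA : ∑ b'' ∈ Ioo b b', E b'' ≤ ∑ x ∈ Ioc b b', E x :=
      sum_le_sum_of_subset_of_nonneg (fun x hx => by rw [mem_Ioo] at hx; rw [mem_Ioc]; omega)
        fun x _ _ => hE x
    have hB : ∑ b'' ∈ Ioo b b', E (b'' + 1) ≤ ∑ x ∈ Ioc b b', E x := by
      rw [← sum_image (g := fun b'' => b'' + 1) (f := E) (s := Ioo b b') (fun x _ y _ h => by simpa using h)]
      refine sum_le_sum_of_subset_of_nonneg (fun x hx => ?_) fun x _ _ => hE x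
      simp only [mem_image, mem_Ioo] at hx
      obtain ⟨y, hy, rfl⟩ := hx
      rw [mem_Ioc]; omega
    rw [sum_add_distrib] at hle
    linarith
  -- (3) `Σ_{(b,b']} E ≤ (1/κ) (J b - J b')`
  have h3 : κ * ∑ x ∈ Ioc b b', E x ≤ J b - J b' := by
    rw [← sum_Ioc_eq_sub J s b b' hbb.le hbal, mul_sum]
    exact sum_le_sum fun x hx => by
      rw [mem_Ioc] at hx
      exact hfgr x hx.1 hx.2
  -- combine: `κ k J b' ≤ 2 (J b - J b')`, i.e. `(κ k + 2) J b' ≤ 2 J b`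
  have hden : 0 < κ * (k : ℝ) + 2 := by positivity
  have h4 : κ * ((k : ℝ) * J b') ≤ 2 * (J b - J b') := by
    have := mul_le_mul_of_nonneg_left (h1.trans h2) hκ.le
    nlinarith [this, h3]
  rw [div_mul_eq_mul_div, le_div_iff₀ hden]
  nlinarith [h4]

/-- [folklore] **The block Beer–Lambert law from sitewise passivity and a local FGR bound** (the `max`-form consumed
by the line's skeleton). Fix a block length `L₀ ≥ 1` and `κ > 0`, and bonds `b + L₀ ≤ b'`. If on the sites of
`(b, b']` the site balance `J (x-1) - J x = s x`, passivity `0 ≤ s x` and the local absorption bound `κ · E x ≤ s x`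
hold, `0 ≤ E`, and the transport bound `J b'' ≤ E b'' + E (b''+1)` holds on the interior bonds, then the work absorbed
in the block is at least the fraction `1 - θ` of the positive part of the incoming flux, with the `N`-FREE ratio
`θ = 2 / (κ (L₀ - 1) + 2) < 1`:  `(1 - θ) · max (J b) 0 ≤ J b - J b'`. -/
theorem blockLaw_of_localFGR :
    ∀ (J s E : ℕ → ℝ) (κ : ℝ) (L₀ b b' : ℕ), 0 < κ → 0 < L₀ → b + L₀ ≤ b' →
      (∀ x, b < x → x ≤ b' → J (x - 1) - J x = s x) → (∀ x, b < x → x ≤ b' → 0 ≤ s x) →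
      (∀ x, b < x → x ≤ b' → κ * E x ≤ s x) → (∀ x, 0 ≤ E x) →
      (∀ b'', b < b'' → b'' < b' → J b'' ≤ E b'' + E (b'' + 1)) →
      (1 - 2 / (κ * ((L₀ - 1 : ℕ) : ℝ) + 2)) * max (J b) 0 ≤ J b - J b' := by
  intro J s E κ L₀ b b' hκ hL₀ hbb hbal hpass hfgr hE htr
  have hsum := sum_Ioc_eq_sub J s b b' (by omega) hbal
  have hnonneg : 0 ≤ J b - J b' := by
    rw [← hsum]
    exact sum_nonneg fun x hx => by rw [mem_Ioc] at hx; exact hpass x hx.1 hx.2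
  set θ₀ : ℝ := 2 / (κ * ((L₀ - 1 : ℕ) : ℝ) + 2) with hθ₀
  have hθ₀le : θ₀ ≤ 1 := by
    rw [hθ₀, div_le_one (by positivity)]
    nlinarith [hκ, (Nat.cast_nonneg (L₀ - 1) : (0 : ℝ) ≤ ((L₀ - 1 : ℕ) : ℝ))]
  rcases le_or_gt (J b) 0 with hneg | hpos
  · rw [max_eq_right hneg]; simpa using hnonneg
  · rw [max_eq_left hpos.le]
    -- the ratio over the actual block (`k = b' - b - 1 ≥ L₀ - 1` interior bonds) is at most `θ₀`
    have hratio := flux_ratio_of_localFGR J s E κ b b' hκ (by omega) hbal hpass hfgr hE htr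
    have hkge : ((L₀ - 1 : ℕ) : ℝ) ≤ ((b' - b - 1 : ℕ) : ℝ) := by exact_mod_cast (by omega : L₀ - 1 ≤ b' - b - 1)
    have hθle : 2 / (κ * ((b' - b - 1 : ℕ) : ℝ) + 2) ≤ θ₀ := by
      rw [hθ₀]
      exact div_le_div_of_nonneg_left (by norm_num) (by positivity) (by nlinarith)
    have : J b' ≤ θ₀ * J b := hratio.trans (mul_le_mul_of_nonneg_right hθle hpos.le)
    nlinarith

end Summit.AtomisticToContinuum.FouriersLaw.Theorems.CoherentDephasing.LocalFGR

end
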